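/-
Origin: expansion seat `planner-pub-hodgecm-pv05-0`, handover 2026-08-18T04:05:37Z (`HOME/pub-hodgecm-pv05/lean/Pv05/KernelOperatorFD.lean`, md5 e9717d63, 187 lines);
landed by the gen-5 packager in gate run 21 as `HodgeCM/PerL34/KernelOperatorFD.lean` (verbatim).
-/
/-
pub-hodgecm speedrun cell, prover pv05 — WIP module `Pv05.KernelOperatorFD` (proposed landing place
`HodgeCM/PerL34/KernelOperatorFD.lean`, namespace `HodgeCM.PerL34.KernelOperatorFD`).  Imports: Mathlib only.
Nothing posited, nothing cited.

# N21 in the fundamental-domain model: `𝒯_Φ` for a bounded kernel on a FINITE-MEASURE (non-compact) domain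

The landed `HodgeCM.PerL34.KernelOperator` (run 19) proves tex ll. 380–383 verbatim: for `X`, `Y` COMPACT and a
continuous kernel `k ∈ C(X × Y, ℂ)`, `𝒯_k : L²(ν) → L²(μ)` is a bounded operator.  The cluster's working model of
`[U(W)]` (pv09 `RallisIP`, pv14 `P36Bridge`, pv15) is NOT a compact type but a FUNDAMENTAL DOMAIN `𝓕 ⊂ U(W)(𝔸)` with
the restricted Haar measure `dh.restrict 𝓕` (finite), and the theta kernel `θ_Φ(g, y)` is a bounded function on
`[G_U] × U(W)(𝔸)`, continuous in `g`, measurable in `y`.  This file redoes N21 in exactly that shape, so that pv14's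
"DEFINITIONAL" binders `hTι`/`hTev` of `P36Bridge.unfoldingIdentity_of` (`𝒯_Φ(E) = ι(g ↦ ∫_{y ∈ 𝓕} θ_Φ(g,y)E(y) dh)`,
`ι = ContinuousMap.toLp`) are discharged by an actual bounded operator:

* hypotheses `IsFDKernel k C`: `∀ y, Continuous (k · y)`, `∀ x, Measurable (k x)`, `‖k x y‖ ≤ C`;
* `evalT k ν v x := ∫ y, k x y * v y ∂ν` for `v ∈ L²(ν)`, `ν` finite (take `ν := dh.restrict 𝓕`: then this IS
  `∫ y in 𝓕, k x y * v y ∂dh`); continuous in `x` by dominated convergence (`continuous_evalT`, `X` first countable);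
  `= ⟪kx x, v⟫` with `kx x ∈ L²(ν)` the conjugate kernel section, hence `‖(𝒯_k v)(x)‖ ≤ ν(Y)^{1/2} C ‖v‖₂`;
* `opTC k ν : L²(ν) →L[ℂ] C(X, ℂ)` (X compact), `opT k μ ν := toLp ∘ opTC : L²(ν) →L[ℂ] L²(μ)`, `opT_eq_toLp` (= the
  shape of `hTι`), `evalT_toLp` (the value on the class of a genuine `L²` function `f` is `∫ k x y * f y`, = `hTev`),
  `norm_opT_le`.
-/
import Mathlib

/-! PORT of `HodgeCM/PerL34/KernelOperatorFD.lean` (HodgeCMPerL run 81) — verbatim mechanical port; provenance in the PORT header line. -/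

set_option autoImplicit false

noncomputable section

open MeasureTheory Complex ComplexConjugate
open scoped InnerProductSpace ENNReal

namespace HodgeCM
namespace PerL34
namespace KernelOperatorFD

variable {X Y : Type*} [TopologicalSpace X] [MeasurableSpace Y]

/-- A bounded kernel, continuous in the first variable and measurable in the second (the theta kernel
`θ_Φ(g,y)` on `[G_U] × U(W)(𝔸)`). -/
structure IsFDKernel (k : X → Y → ℂ) (C : ℝ) : Prop where
  cont : ∀ y, Continuous fun x => k x y
  meas : ∀ x, Measurable (k x)
  nonneg : 0 ≤ C
  bound : ∀ x y, ‖k x y‖ ≤ C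

variable (ν : Measure Y) [IsFiniteMeasure ν] {k : X → Y → ℂ} {C : ℝ}

/-- An `L²` class on a finite measure space is integrable. -/
theorem integrable_of_Lp2 (v : Lp ℂ 2 ν) : Integrable (v : Y → ℂ) ν :=
  (Lp.memLp v).integrable (by norm_num)

/-- `(𝒯_k v)(x) := ∫_Y k(x,y) v(y) dν(y)` (tex l. 380; with `ν = dh.restrict 𝓕` this is `∫ y in 𝓕, … ∂dh`). -/
def evalT (k : X → Y → ℂ) (ν : Measure Y) (v : Lp ℂ 2 ν) (x : X) : ℂ := ∫ y, k x y * v y ∂ν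

omit [TopologicalSpace X] [IsFiniteMeasure ν] in
/-- (Ported verbatim from the HodgeCMPerL package; no docstring in the source.) -/
theorem evalT_def (v : Lp ℂ 2 ν) (x : X) : evalT k ν v x = ∫ y, k x y * v y ∂ν := rfl

omit [TopologicalSpace X] [IsFiniteMeasure ν] in
/-- On the class of a genuine square-integrable function `f`, `𝒯_k` is the integral against `f` itself
(pv14's `hTev` shape). -/
theorem evalT_toLp {f : Y → ℂ} (hf : MemLp f 2 ν) (x : X) :
    evalT k ν (hf.toLp f) x = ∫ y, k x y * f y ∂ν :=
  integral_congr_ae (by filter_upwards [hf.coeFn_toLp] with y hy; rw [hy])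

/-- The conjugate kernel section `y ↦ \overline{k(x,y)}` is in `L²(ν)` (bounded, measurable, `ν` finite). -/
theorem memLp_kx (hk : IsFDKernel k C) (x : X) : MemLp (fun y => conj (k x y)) 2 ν :=
  MemLp.of_bound (continuous_conj.measurable.comp (hk.meas x)).aestronglyMeasurable C
    (ae_of_all ν fun y => by rw [Complex.norm_conj]; exact hk.bound x y)

/-- The kernel section as an element of `L²(ν)`. -/
def kx (hk : IsFDKernel k C) (x : X) : Lp ℂ 2 ν := (memLp_kx ν hk x).toLp _

/-- (Ported verbatim from the HodgeCMPerL package; no docstring in the source.) -/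
theorem kx_coeFn (hk : IsFDKernel k C) (x : X) : (kx ν hk x : Y → ℂ) =ᵐ[ν] fun y => conj (k x y) :=
  MemLp.coeFn_toLp _

/-- `(𝒯_k v)(x) = ⟪kx x, v⟫_{L²(ν)}`. -/
theorem evalT_eq_inner (hk : IsFDKernel k C) (v : Lp ℂ 2 ν) (x : X) :
    evalT k ν v x = ⟪kx ν hk x, v⟫_ℂ := by
  rw [L2.inner_def, evalT_def]
  apply integral_congr_ae
  filter_upwards [kx_coeFn ν hk x] with y hy
  rw [hy]
  simp [mul_comm]

/-- (Ported verbatim from the HodgeCMPerL package; no docstring in the source.) -/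
theorem norm_kx_le (hk : IsFDKernel k C) (x : X) :
    ‖kx ν hk x‖ ≤ (measureUnivNNReal ν : ℝ) ^ (2 : ℝ)⁻¹ * C := by
  have h2 : (2 : ℝ≥0∞).toReal⁻¹ = (2 : ℝ)⁻¹ := by norm_num
  have hb : ∀ᵐ y ∂ν, ‖(kx ν hk x : Y → ℂ) y‖ ≤ C := by
    filter_upwards [kx_coeFn ν hk x] with y hy
    rw [hy, Complex.norm_conj]
    exact hk.bound x y
  have := Lp.norm_le_of_ae_bound hk.nonneg hb
  simpa [h2] using this

/-- Cauchy–Schwarz: `‖(𝒯_k v)(x)‖ ≤ ν(Y)^{1/2} · C · ‖v‖₂`. -/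
theorem norm_evalT_le (hk : IsFDKernel k C) (v : Lp ℂ 2 ν) (x : X) :
    ‖evalT k ν v x‖ ≤ (measureUnivNNReal ν : ℝ) ^ (2 : ℝ)⁻¹ * C * ‖v‖ := by
  rw [evalT_eq_inner ν hk]
  exact (norm_inner_le_norm _ _).trans (mul_le_mul_of_nonneg_right (norm_kx_le ν hk x) (norm_nonneg v))

/-- (Ported verbatim from the HodgeCMPerL package; no docstring in the source.) -/
theorem evalT_add (hk : IsFDKernel k C) (v w : Lp ℂ 2 ν) (x : X) :
    evalT k ν (v + w) x = evalT k ν v x + evalT k ν w x := by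
  simp only [evalT_eq_inner ν hk, inner_add_right]

/-- (Ported verbatim from the HodgeCMPerL package; no docstring in the source.) -/
theorem evalT_smul (hk : IsFDKernel k C) (c : ℂ) (v : Lp ℂ 2 ν) (x : X) :
    evalT k ν (c • v) x = c * evalT k ν v x := by
  simp only [evalT_eq_inner ν hk, inner_smul_right]

/-- **Continuity in `x`** (dominated convergence: the integrand is dominated by `C‖v‖ ∈ L¹(ν)` and is
continuous in `x` for every `y`). -/
theorem continuous_evalT [FirstCountableTopology X] (hk : IsFDKernel k C) (v : Lp ℂ 2 ν) :
    Continuous (evalT k ν v) := by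
  refine continuous_of_dominated (bound := fun y => C * ‖(v : Y → ℂ) y‖) ?_ ?_ ?_ ?_
  · intro x
    exact (hk.meas x).aestronglyMeasurable.mul (Lp.aestronglyMeasurable v)
  · intro x
    filter_upwards with y
    rw [norm_mul]
    exact mul_le_mul_of_nonneg_right (hk.bound x y) (norm_nonneg _)
  · exact (integrable_of_Lp2 ν v).norm.const_mul C
  · filter_upwards with y
    exact (hk.cont y).mul continuous_const

/-- `𝒯_k v ∈ C(X, ℂ)`. -/
def evalTC [FirstCountableTopology X] (hk : IsFDKernel k C) (v : Lp ℂ 2 ν) : C(X, ℂ) :=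
  ⟨evalT k ν v, continuous_evalT ν hk v⟩

/-- (Ported verbatim from the HodgeCMPerL package; no docstring in the source.) -/
@[simp] theorem evalTC_apply [FirstCountableTopology X] (hk : IsFDKernel k C) (v : Lp ℂ 2 ν) (x : X) :
    evalTC ν hk v x = ∫ y, k x y * v y ∂ν := rfl

section Compact

variable [FirstCountableTopology X] [CompactSpace X]

/-- (Ported verbatim from the HodgeCMPerL package; no docstring in the source.) -/
theorem norm_evalTC_le (hk : IsFDKernel k C) (v : Lp ℂ 2 ν) :
    ‖evalTC ν hk v‖ ≤ (measureUnivNNReal ν : ℝ) ^ (2 : ℝ)⁻¹ * C * ‖v‖ :=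
  (ContinuousMap.norm_le _ (by have := hk.nonneg; positivity)).mpr (fun x => norm_evalT_le ν hk v x)

/-- `v ↦ 𝒯_k v` as a bounded linear map `L²(ν) → C(X, ℂ)`. -/
def opTC (hk : IsFDKernel k C) : Lp ℂ 2 ν →L[ℂ] C(X, ℂ) :=
  LinearMap.mkContinuous
    { toFun := evalTC ν hk
      map_add' := fun v w => by ext x; simp [evalTC, evalT_add ν hk]
      map_smul' := fun c v => by ext x; simp [evalTC, evalT_smul ν hk] }
    ((measureUnivNNReal ν : ℝ) ^ (2 : ℝ)⁻¹ * C) (fun v => norm_evalTC_le ν hk v)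

/-- (Ported verbatim from the HodgeCMPerL package; no docstring in the source.) -/
@[simp] theorem opTC_apply (hk : IsFDKernel k C) (v : Lp ℂ 2 ν) (x : X) :
    opTC ν hk v x = ∫ y, k x y * v y ∂ν := rfl

/-- (Ported verbatim from the HodgeCMPerL package; no docstring in the source.) -/
theorem norm_opTC_le (hk : IsFDKernel k C) :
    ‖opTC ν hk‖ ≤ (measureUnivNNReal ν : ℝ) ^ (2 : ℝ)⁻¹ * C :=
  LinearMap.mkContinuous_norm_le _ (by have := hk.nonneg; positivity) _

variable [MeasurableSpace X] [BorelSpace X] (μ : Measure X) [IsFiniteMeasure μ]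

/-- **`𝒯_k : L²(ν) → L²(μ)` bounded** (tex ll. 381–382), in the fundamental-domain model. -/
def opT (hk : IsFDKernel k C) : Lp ℂ 2 ν →L[ℂ] Lp ℂ 2 μ :=
  (ContinuousMap.toLp (E := ℂ) 2 μ ℂ).comp (opTC ν hk)

/-- pv14's `hTι` shape: `𝒯_k v = ι (g ↦ ∫ k g y · v y dν)` with `ι = ContinuousMap.toLp 2 μ ℂ`. -/
theorem opT_eq_toLp (hk : IsFDKernel k C) (v : Lp ℂ 2 ν) :
    opT ν μ hk v = ContinuousMap.toLp (E := ℂ) 2 μ ℂ (evalTC ν hk v) := rfl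

/-- (Ported verbatim from the HodgeCMPerL package; no docstring in the source.) -/
theorem opT_apply_coeFn (hk : IsFDKernel k C) (v : Lp ℂ 2 ν) :
    (opT ν μ hk v : X → ℂ) =ᵐ[μ] fun x => ∫ y, k x y * v y ∂ν := by
  rw [opT_eq_toLp]
  filter_upwards [ContinuousMap.coeFn_toLp (E := ℂ) (p := 2) (𝕜 := ℂ) μ (evalTC ν hk v)] with x hx
  rw [hx, evalTC_apply]

/-- (Ported verbatim from the HodgeCMPerL package; no docstring in the source.) -/
theorem norm_opT_le (hk : IsFDKernel k C) :
    ‖opT ν μ hk‖ ≤ (measureUnivNNReal μ : ℝ) ^ (2 : ℝ)⁻¹ * ((measureUnivNNReal ν : ℝ) ^ (2 : ℝ)⁻¹ * C) := by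
  have h2 : (2 : ℝ≥0∞).toReal⁻¹ = (2 : ℝ)⁻¹ := by norm_num
  have hT : ‖(ContinuousMap.toLp (E := ℂ) 2 μ ℂ : C(X, ℂ) →L[ℂ] Lp ℂ 2 μ)‖ ≤
      (measureUnivNNReal μ : ℝ) ^ (2 : ℝ)⁻¹ := by
    have := ContinuousMap.toLp_norm_le (E := ℂ) (p := 2) (𝕜 := ℂ) μ
    simpa [h2] using this
  exact (ContinuousLinearMap.opNorm_comp_le _ _).trans
    (mul_le_mul hT (norm_opTC_le ν hk) (norm_nonneg _) (by positivity))

end Compact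

end KernelOperatorFD
end PerL34
end HodgeCM

end
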